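import Summits.Ventures.CertifiedArithmetic.LowPrec.GemmThetaLawGenE2M3Data

/-!
# E2M3×E2M3 law check, part 11/11: `bin 10`, `bin 11`

HONEST FRAMING (venture CertifiedArithmetic / cell `pub-lowprec`, seat gemm, gen 13): certified
error envelopes and provably optimal rounding/accumulation schemes for low-precision formats under
stated cost models; every table by two implementations; no hardware or vendor claims.

Part 11/11 of the per-level kernel check of `e2m3Law.lawCheck` (see
`GemmThetaLawGenE2M3Data.lean`): `bin 10`, `bin 11` (2286 + 2214 classes). [cell]
-/

namespace Literature.ComputerArithmetic.FloatingPoint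

namespace MiniFloat

namespace ThetaLaw

/-- Level `bin 10` of the E2M3×E2M3 law check passes (2286 classes, both signs, all 443 letters).
[cell, kernel `decide`] -/
theorem levCheck_e2m3_b10 : e2m3Law.levCheck (Lev.bin 10) = true := by
  decide +kernel

/-- Level `bin 11` of the E2M3×E2M3 law check passes (2214 classes, both signs, all 443 letters).
[cell, kernel `decide`] -/
theorem levCheck_e2m3_b11 : e2m3Law.levCheck (Lev.bin 11) = true := by
  decide +kernel

end ThetaLaw

end MiniFloat

end Literature.ComputerArithmetic.FloatingPoint
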